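import Literature.NumberTheory.Transcendental.LWMeasureAnalytic
import Literature.NumberTheory.Transcendental.DiazZeroLemmaMult
import Literature.NumberTheory.Transcendental.PhilipponZeroEstimateHolds
import HarnessLib

/-!
# The auxiliary polynomials of the Lindemann–Weierstrass measure (Ably 1994, §II, Lemme 3) — no common zero near θ

`Literature/NumberTheory/Transcendental/LWMeasureZeroFree.lean` — proofs (and three
abbreviations with bodies), no named facts. Fifth file of the proof of Ably's "Proposition
principale" behind `Ably1994_lindemannWeierstrass_measure`: Lemme 3 (pp. 39–40), the zero
estimate step, in the form "a common zero `(α, z)` of all `Q_{s,h,j}` (`s < T`, `h ∈ [0,M)ⁿ`) near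
`θ` forces a small non-trivial integer relation `|∑ μ_k y_k| ≤ (D−1)²B²Δe^{−V}`,
`|μ_k| ≤ (D−1)B²Δ`" — which Liouville's inequality (`LWMeasureAlgebraicData.lean`) excludes for
the final parameters.

* `Setup.wlog` — logarithms `ỹ_k` of the perturbed point (`e^{ỹ_k} = z_k`, `|ỹ_k − y_k|` small).
* `Setup.Pzx` — `P(Z, X) = ∑ P_{β,γ,j}(α, z) Z^β X^γ ∈ ℂ[Z, X]` (p. 40), non-zero for `j` minimal,
  `deg_Z ≤ L − 1`, `deg_X ≤ D − 1`; `Setup.evalAt_Pzx`, `Setup.iteratedDeriv_evalAt_Pzx` — on the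
  translate of `t ↦ (t, e^t) ⊂ 𝔾ₐ × 𝔾ₘ` through `(h·y, e^{h·ỹ})`,
  `c^L (d/dt)^s P(…)|_{t=0} = Q_{s,h,j}(α, z)` (`LWMeasureAnalytic.aeval_Qj_eq_iteratedDeriv`).
* `Setup.exists_relation_of_vanishing` — the contrapositive core of Lemme 3 from the tree's
  perturbed zero estimate with multiplicities on `𝔾ₐ × 𝔾ₘ`
  (`DiazZLM.zeroLemmaMult_of_GaGm'`, constant from `Philippon1986_GaGm_holds`), with Ably's
  parameter conditions (C₃) `c_z(L−1)(D−1) < (T_z+1)(B+1)ⁿ`, (C₄) `c_z(D−1) < (T_z+1)(B+1)^{n−1}`.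

## References

* [Ably1994] M. Ably, *Une version quantitative du théorème de Lindemann–Weierstrass*, Acta Arith.
  67 (1994) 29–45, §II Lemme 3 pp. 39–40.
* [Philippon1986] P. Philippon, *Lemmes de zéros dans les groupes algébriques commutatifs*,
  Bull. SMF 114 (1986), Thm 2.1.
* [Diaz1989] G. Diaz, J. Number Theory 31 (1989), §II-3-4 (the perturbed zero lemma).
-/

noncomputable section

open scoped Polynomial
open MvPolynomial Finset Finsupp Complex

namespace Literature.NumberTheory.Transcendental

namespace LWMeasure

open GaGm DiazZL DiazZLM

namespace Setup

variable (S : Setup) {L D b : ℕ}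

/-! ### Logarithms of the perturbed point -/

/-- `ỹ_k = y_k + log(z_k e^{-y_k})` (principal logarithm): `e^{ỹ_k} = z_k`, and `ỹ_k` is close to
`y_k` when `z_k` is close to `e^{y_k}` (Ably, p. 39: "Soit, alors, `ỹᵢ ∈ ℂ` tel que
`e^{ỹᵢ} = θ̃ᵢ`"). [cite: Ably1994, §II Lemme 3 p. 39] -/
def wlog (z : Fin S.n → ℂ) (k : Fin S.n) : ℂ := S.y k + Complex.log (z k * cexp (-S.y k))

/-- `e^{ỹ_k} = z_k` for `z_k ≠ 0`. [folklore] -/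
theorem exp_wlog {z : Fin S.n → ℂ} (k : Fin S.n) (hz : z k ≠ 0) : cexp (S.wlog z k) = z k := by
  unfold wlog
  rw [Complex.exp_add, Complex.exp_log (mul_ne_zero hz (Complex.exp_ne_zero _)), mul_left_comm,
    ← Complex.exp_add, add_neg_cancel, Complex.exp_zero, mul_one]

/-- `|ỹ_k - y_k| ≤ (3/2)|z_k - e^{y_k}|·|e^{-y_k}|` when that product is `≤ 1/2`. [folklore] -/
theorem norm_wlog_sub_le {z : Fin S.n → ℂ} (k : Fin S.n)
    (hsmall : ‖z k - S.θ k‖ * ‖cexp (-S.y k)‖ ≤ 1 / 2) :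
    ‖S.wlog z k - S.y k‖ ≤ 3 / 2 * (‖z k - S.θ k‖ * ‖cexp (-S.y k)‖) := by
  set w : ℂ := z k * cexp (-S.y k) - 1 with hw
  have hw' : w = (z k - S.θ k) * cexp (-S.y k) := by
    rw [hw, sub_mul, θ_apply, ← Complex.exp_add, add_neg_cancel, Complex.exp_zero]
  have hnw : ‖w‖ = ‖z k - S.θ k‖ * ‖cexp (-S.y k)‖ := by rw [hw', norm_mul]
  have h1 : S.wlog z k - S.y k = Complex.log (1 + w) := by
    unfold wlog
    rw [hw]
    ring_nf
  rw [h1, ← hnw]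
  exact Complex.norm_log_one_add_half_le_self (by rw [hnw]; exact hsmall)

/-! ### The polynomial on `𝔾ₐ × 𝔾ₘ` attached to a perturbed point -/

/-- The exponent `(β, γ)` in `ℂ[Z, X]`. [folklore] -/
def expZX (βγ : Fin L × Fin D) : Fin 2 →₀ ℕ :=
  Finsupp.single 0 (βγ.1 : ℕ) + Finsupp.single 1 (βγ.2 : ℕ)

/-- `expZX` at `0`. [folklore] -/
@[simp] theorem expZX_zero (βγ : Fin L × Fin D) : expZX βγ 0 = (βγ.1 : ℕ) := by
  simp [expZX]

/-- `expZX` at `1`. [folklore] -/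
@[simp] theorem expZX_one (βγ : Fin L × Fin D) : expZX βγ 1 = (βγ.2 : ℕ) := by
  simp [expZX]

/-- `expZX` is injective. [folklore] -/
theorem expZX_injective : Function.Injective (expZX (L := L) (D := D)) := by
  intro a a' h
  have h0 := congrArg (fun f => f 0) h
  have h1 := congrArg (fun f => f 1) h
  simp only [expZX_zero, expZX_one] at h0 h1
  exact Prod.ext (Fin.ext h0) (Fin.ext h1)

/-- **`P(Z, X) = ∑_{β,γ} P_{β,γ,j}(α, z) Z^β X^γ ∈ ℂ[Z, X]`**, the polynomial on `𝔾ₐ × 𝔾ₘ` of the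
proof of Lemme 3 (p. 40). [cite: Ably1994, §II Lemme 3 p. 40] -/
def Pzx (p : Unk S.n L D b → ℤ) (z : Fin S.n → ℂ) (j : Fin (S.n + 1) →₀ ℕ) :
    MvPolynomial (Fin 2) ℂ :=
  ∑ βγ : Fin L × Fin D, monomial (expZX βγ)
    (aeval (Fin.cons S.α z : Fin (S.n + 1) → ℂ) (S.Pj p βγ j))

/-- The coefficient of `Z^β X^γ` in `P` is `P_{β,γ,j}(α, z)`. [folklore] -/
theorem coeff_Pzx (p : Unk S.n L D b → ℤ) (z : Fin S.n → ℂ) (j : Fin (S.n + 1) →₀ ℕ)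
    (βγ : Fin L × Fin D) :
    coeff (expZX βγ) (S.Pzx p z j) = aeval (Fin.cons S.α z : Fin (S.n + 1) → ℂ) (S.Pj p βγ j) := by
  classical
  unfold Pzx
  rw [coeff_sum, Finset.sum_eq_single βγ]
  · rw [coeff_monomial, if_pos rfl]
  · intro a' _ hne
    rw [coeff_monomial, if_neg fun h => hne (expZX_injective h)]
  · intro h
    exact absurd (Finset.mem_univ βγ) h

/-- **`P ≠ 0`** when `j` is minimal at `(α, z)` (p. 40: "les coefficients `D^jP_{β,γ}(θ̃)` de `P`
ne sont pas tous nuls"). [cite: Ably1994, §II Lemme 3 p. 40] -/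
theorem Pzx_ne_zero {p : Unk S.n L D b → ℤ} {z : Fin S.n → ℂ} {j : Fin (S.n + 1) →₀ ℕ}
    (hj : S.IsMinIdx p (Fin.cons S.α z) j) : S.Pzx p z j ≠ 0 := by
  obtain ⟨βγ, hβγ⟩ := hj.1
  intro h0
  apply hβγ
  have := S.coeff_Pzx p z j βγ
  rw [h0, coeff_zero] at this
  exact this.symm

/-- The monomials of `P`. [folklore] -/
theorem eq_expZX_of_mem_support_Pzx {p : Unk S.n L D b → ℤ} {z : Fin S.n → ℂ}
    {j : Fin (S.n + 1) →₀ ℕ} {e : Fin 2 →₀ ℕ} (he : e ∈ (S.Pzx p z j).support) :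
    ∃ βγ : Fin L × Fin D, e = expZX βγ := by
  classical
  rw [MvPolynomial.mem_support_iff] at he
  unfold Pzx at he
  rw [coeff_sum] at he
  obtain ⟨βγ, _, h⟩ := Finset.exists_ne_zero_of_sum_ne_zero he
  rw [coeff_monomial] at h
  exact ⟨βγ, by by_contra h'; exact h (if_neg (Ne.symm h'))⟩

/-- `deg_Z P ≤ L - 1`. [folklore] -/
theorem degreeOf_Pzx_zero_le (p : Unk S.n L D b → ℤ) (z : Fin S.n → ℂ)
    (j : Fin (S.n + 1) →₀ ℕ) : degreeOf 0 (S.Pzx p z j) ≤ L - 1 := by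
  classical
  rw [degreeOf_le_iff]
  intro e he
  obtain ⟨βγ, rfl⟩ := S.eq_expZX_of_mem_support_Pzx he
  have := βγ.1.isLt
  simp only [expZX_zero]
  omega

/-- `deg_X P ≤ D - 1`. [folklore] -/
theorem degreeOf_Pzx_one_le (p : Unk S.n L D b → ℤ) (z : Fin S.n → ℂ)
    (j : Fin (S.n + 1) →₀ ℕ) : degreeOf 1 (S.Pzx p z j) ≤ D - 1 := by
  classical
  rw [degreeOf_le_iff]
  intro e he
  obtain ⟨βγ, rfl⟩ := S.eq_expZX_of_mem_support_Pzx he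
  have := βγ.2.isLt
  simp only [expZX_one]
  omega

/-- **`P` on the translate of the one-parameter subgroup `t ↦ (t, e^t)`** through the point
`(h·y, e^{h·ỹ})`: `P((h·y, e^{h·ỹ}) · (t, e^t)) = ∑ P_{β,γ,j}(α,z) (h·y + t)^β (z^h e^t)^γ`
(`e^{ỹ_k} = z_k`; Ably's `F_h(z) = P(h·y + z, e^{h·ỹ + z})`, p. 40).
[cite: Ably1994, §II Lemme 3 p. 40] -/
theorem evalAt_Pzx (p : Unk S.n L D b → ℤ) {z : Fin S.n → ℂ} (hz : ∀ k, z k ≠ 0)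
    (j : Fin (S.n + 1) →₀ ℕ) (h : Fin S.n → ℕ) (t : ℂ) :
    evalAt (S.Pzx p z j) (sig S.y (fun _ : Fin 1 => S.wlog z) (fun k => (h k : ℤ)) *
        GaGm.exp (t • ((1 : ℂ), fun _ : Fin 1 => (1 : ℂ)))) =
      ∑ β : Fin L, ∑ γ : Fin D, aeval (Fin.cons S.α z : Fin (S.n + 1) → ℂ) (S.Pj p (β, γ) j) *
        (S.hy h + t) ^ (β : ℕ) * ((∏ k, z k ^ h k) * cexp t) ^ (γ : ℕ) := by
  classical
  rw [evalAt, coord_mul_exp_smul]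
  unfold Pzx
  rw [map_sum, Fintype.sum_prod_type]
  refine Finset.sum_congr rfl fun β _ => Finset.sum_congr rfl fun γ _ => ?_
  rw [eval_monomial, Finsupp.prod_fintype _ _ (fun i => by simp), Fin.prod_univ_two,
    expZX_zero, expZX_one]
  simp only [Fin.cons_zero]
  have h0 : Multiplicative.toAdd (sig S.y (fun _ : Fin 1 => S.wlog z) (fun k => (h k : ℤ))).1 +
      t * (1 : ℂ) = S.hy h + t := by
    simp only [sig, GaGm.exp, wv, toAdd_ofAdd, Int.cast_natCast, mul_one, hy]
  have h1 : ((((sig S.y (fun _ : Fin 1 => S.wlog z) (fun k => (h k : ℤ))).2 0 : ℂˣ) : ℂ) *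
      cexp (t * (1 : ℂ))) = (∏ k, z k ^ h k) * cexp t := by
    simp only [sig, GaGm.exp, wv, Units.val_mk0, Int.cast_natCast, mul_one]
    rw [Complex.exp_sum]
    congr 1
    refine Finset.prod_congr rfl fun k _ => ?_
    rw [← S.exp_wlog k (hz k), ← Complex.exp_nat_mul]
  rw [h0]
  have : (Fin.cons (S.hy h + t)
      (fun j : Fin 1 => (((sig S.y (fun _ : Fin 1 => S.wlog z) (fun k => (h k : ℤ))).2 j : ℂˣ) : ℂ) *
        cexp (t * (1 : ℂ))) : Fin 2 → ℂ) 1 = (∏ k, z k ^ h k) * cexp t := by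
    rw [show (1 : Fin 2) = Fin.succ 0 from rfl, Fin.cons_succ]
    exact h1
  rw [this]
  ring

/-- **The vanishing of the family at `(α, z)` is the vanishing of `P` to high order along
`(1, 1)`**: `(d/dt)^s P((h·y, e^{h·ỹ})·(t, e^t))|_{t=0} = c^{-L} Q_{s,h,j}(α, z)`.
[cite: Ably1994, §II Lemme 3 p. 40 ("`(d^s/dz^s) F_h(0) = Q_{s,h,j}(θ̃)`")] -/
theorem iteratedDeriv_evalAt_Pzx (p : Unk S.n L D b → ℤ) {z : Fin S.n → ℂ} (hz : ∀ k, z k ≠ 0)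
    (j : Fin (S.n + 1) →₀ ℕ) (h : Fin S.n → ℕ) (s : ℕ) :
    (S.c : ℂ) ^ L * iteratedDeriv s (fun t : ℂ => evalAt (S.Pzx p z j)
      (sig S.y (fun _ : Fin 1 => S.wlog z) (fun k => (h k : ℤ)) *
        GaGm.exp (t • ((1 : ℂ), fun _ : Fin 1 => (1 : ℂ))))) 0 =
      aeval (Fin.cons S.α z : Fin (S.n + 1) → ℂ) (S.Qj p h s j) := by
  rw [S.aeval_Qj_eq_iteratedDeriv]
  congr 2
  funext t
  exact S.evalAt_Pzx p hz j h t

/-! ### Lemme 3: a common zero near `θ` forces a small integer relation among the `y_k` -/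

/-- **Lemme 3 (contrapositive core), from Philippon's zero estimate with multiplicities.** There
is an absolute `c_z ∈ ℕ` such that: if `j` is minimal at `(α, z)` (all `z_k ≠ 0`), the
logarithms `ỹ` of `z` satisfy `∑|ỹ_k − y_k| ≤ e^{−V}`, `∑|ỹ_k| ≤ Δ`, `π ≤ Δ`, `π|y₁| ≤ Δ`, all
`Q_{s,h,j}` (`s < T`, `h ∈ [0,M)ⁿ`) vanish at `(α, z)`, and the parameters satisfy `2B < M`,
`2T_z + 1 ≤ T`, `c_z (L−1)(D−1) < (T_z+1)(B+1)ⁿ`, `c_z (D−1) < (T_z+1)(B+1)^{n−1}`, then some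
non-zero `μ ∈ ℤⁿ` with `|μ_k| ≤ (D−1)B²Δ` has `|∑ μ_k y_k| ≤ (D−1)²B²Δ e^{−V}` (Ably: the
subgroup `G'` of (7) has `G'₁ = 0` or `G'₁ = 𝔾ₐ`, and the count contradicts (C₃) or (C₄); here the
tree's perturbed zero lemma `DiazZLM.zeroLemmaMult_of_GaGm'` returns the small relation, to be
excluded by Liouville's inequality). [cite: Ably1994, §II Lemme 3 pp. 39–40]
[cite: Philippon1986, Thm 2.1 (the zero estimate used)] -/
theorem exists_relation_of_vanishing (S : Setup) :
    ∃ cz : ℕ, ∀ (L D b M T B Tz : ℕ) (p : Unk S.n L D b → ℤ) (z : Fin S.n → ℂ)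
      (j : Fin (S.n + 1) →₀ ℕ) (V Δ : ℝ),
      (∀ k, z k ≠ 0) → S.IsMinIdx p (Fin.cons S.α z) j →
      (∑ k, ‖S.wlog z k - S.y k‖) ≤ Real.exp (-V) → (∑ k, ‖S.wlog z k‖) ≤ Δ →
      Real.pi ≤ Δ → Real.pi * ‖S.y ⟨0, S.one_le_n⟩‖ ≤ Δ →
      2 ≤ L → 2 ≤ D → 1 ≤ B → 2 * B < M → 2 * Tz + 1 ≤ T →
      (∀ h : Fin S.n → ℕ, (∀ k, h k < M) → ∀ s < T,
        aeval (Fin.cons S.α z : Fin (S.n + 1) → ℂ) (S.Qj p h s j) = 0) →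
      cz * (L - 1) * (D - 1) < (Tz + 1) * (B + 1) ^ S.n →
      cz * (D - 1) < (Tz + 1) * (B + 1) ^ (S.n - 1) →
      ∃ mu : Fin S.n → ℤ, mu ≠ 0 ∧ (∀ k, (|mu k| : ℝ) ≤ (D - 1 : ℕ) * B ^ 2 * Δ) ∧
        ‖∑ k, (mu k : ℂ) * S.y k‖ ≤ ((D - 1 : ℕ) : ℝ) ^ 2 * B ^ 2 * Δ * Real.exp (-V) := by
  obtain ⟨c, hc⟩ := zeroLemmaMult_of_GaGm' Philippon1986_GaGm_holds 1 le_rfl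
  refine ⟨c, ?_⟩
  intro L D b M T B Tz p z j V Δ hz0 hj hV hΔw hΔ hΔy hL hD hB hBM hTz hvan hC1 hC2
  -- the vanishing hypothesis of the zero lemma
  have hvan' : ∀ μ : Fin S.n → ℕ, (∀ k, μ k ≤ (1 + 1) * B) → ∀ s < (1 + 1) * Tz + 1,
      iteratedDeriv s (fun t : ℂ => evalAt (S.Pzx p z j)
        (sig S.y (fun _ : Fin 1 => S.wlog z) (fun k => (μ k : ℤ)) *
          GaGm.exp (t • ((1 : ℂ), fun _ : Fin 1 => (1 : ℂ))))) 0 = 0 := by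
    intro μ hμ s hs
    have h1 := S.iteratedDeriv_evalAt_Pzx p hz0 j μ s
    rw [hvan μ (fun k => by have := hμ k; omega) s (by omega)] at h1
    have hc0 : (S.c : ℂ) ^ L ≠ 0 := pow_ne_zero _ (Int.cast_ne_zero.mpr S.c_ne)
    exact (mul_eq_zero.mp h1).resolve_left hc0
  have hD1 : 1 ≤ D - 1 := by omega
  have hL1 : 1 ≤ L - 1 := by omega
  obtain ⟨lam, mu, hlam, hmu, hlamL, hmuB, hprod⟩ :=
    hc S.n S.one_le_n B Tz (L - 1) (D - 1) V Δ hB hL1 hD1 hΔ (fun _ => 1) (fun _ => 1) S.y S.y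
      (fun _ => S.wlog z)
      (by simpa using hV) (by simp [(Real.exp_pos _).le]) (by simp [(Real.exp_pos _).le])
      (by simpa using hΔw) (by simpa using hΔ) hΔy
      (S.Pzx p z j) (S.Pzx_ne_zero hj) (S.degreeOf_Pzx_zero_le p z j)
      (fun h => by
        have : h = 0 := Subsingleton.elim _ _
        subst this
        exact S.degreeOf_Pzx_one_le p z j)
      hvan' (by simpa [mul_comm, mul_assoc, mul_left_comm] using hC1) (by simpa using hC2)
  refine ⟨mu, hmu, hmuB, ?_⟩
  -- `|λ·1| ≥ 1`
  have hlam1 : (1 : ℝ) ≤ ‖∑ h : Fin 1, (lam h : ℂ) * (1 : ℂ)‖ := by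
    rw [Fin.sum_univ_one, mul_one, Complex.norm_intCast]
    have : lam 0 ≠ 0 := fun h0 => hlam (funext fun i => by
      have : i = 0 := Subsingleton.elim _ _
      subst this; exact h0)
    exact_mod_cast Int.one_le_abs this
  have h0 : 0 ≤ ‖∑ k, (mu k : ℂ) * S.y k‖ := norm_nonneg _
  calc ‖∑ k, (mu k : ℂ) * S.y k‖ ≤ ‖∑ h : Fin 1, (lam h : ℂ) * (1 : ℂ)‖ * ‖∑ k, (mu k : ℂ) * S.y k‖ :=
        le_mul_of_one_le_left h0 hlam1
    _ ≤ _ := hprod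

end Setup

end LWMeasure

end Literature.NumberTheory.Transcendental

end
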